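import Summits.ABC.IUTFork.Thm311RealInd1StripPrimeStrictnessDyadicUnion
import Summits.ABC.IUTFork.Thm311RealInd1StripPrimeStrictnessDyadic
import Summits.ABC.IUTFork.Thm311RealInd1StripGlobalDichotomy
import HarnessLib

/-!
# [IUTchIII] Thm 3.11 (i) (Ind1)+(Ind2) ⟶ Cor 3.12, GLOBAL level, over a genuine Θ-volume input whose field contains `√−1` and whose places over `2` all
# have local degree `2`: the nonarchimedean Θ-side over print's (Ind1)⊔(Ind2) AS TYPED (any prime-indexed factorwise-strip `H ≤ indTwo`) is STRICTLY below
# Dupuy–Hilado's `−|log(Θ)|^{(P),nonarch}` (resp. `−|log(Θ)|^{nonarch}`) — the GLOBAL identity of R31/R32 FAILS AS TYPED for every such input, whatever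
# happens at the odd primes (UNCONDITIONAL; no room condition, no Jannsen–Wingberg / Diekert–Nishio binder)

PROOF-ONLY file (abc-iut cell, Cor. 3.12 sub-crew, seat abc-iut-c312-1 = holder of record of the typed [IUTchIII] Thm. 3.11, gen 27; row
«C:P2-PRIME-DICHOTOMY ⟹ STRICTNESS», file 5 = the INPUT-LEVEL and GLOBAL ports of files 3/4 (`Thm311RealInd1StripPrimeStrictnessDyadic{,Union}`), pattern of
gen 22's R31 `Thm311RealInd1StripGlobalStrictness` §3 and gen 23's R32 `Thm311RealInd1StripGlobalDichotomy` §1 (`2 ∈ T(I)` always, `two_mem_supportPrimes`)).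
TAKES NO SIDE on [IUTchIII] Cor. 3.12.  No definition, no `Prop` fact, no instance, no notation.

SETTING (as R31/R32): a genuine Θ-volume input `I : ThetaVolumeInput F₀ K` (support primes `T(I) ∋ 2`; Mochizuki's shell normalisation `packetAt`; GENUINE
completions `K_{v̲} = RescaledCompletion K p v̲` of the section `I.σ`), the sharp Θ-idele `I.tΘ`, and a PRIME-INDEXED family `H = (H_{p,j,v⃗}) ≤ indTwo`; «the
nonarchimedean Θ-side over `H`» in reading (P) (resp. (U)) is INLINE as in R31: `Σ_{p∈T(I)} [p prime] ln ν̄_{𝕃_p}(v⃗ ↦ hull(⋃_{g∈H_{p,v⃗}} g(O_𝕃(−P_Θ)_{v⃗})))`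
(resp. with the (Ind1)-slot-union inside).  DYADIC HYPOTHESES: `K ∋ s` with `s² = −1` (for genuine initial Θ-data `√−1 ∈ F ⊆ K`, [IUTchI] Def. 3.1 (a)) and
every place `v̲` of the section over `2` of local degree `2` (`K_{v̲} ≅ ℚ₂(√−1)`); `H_{2,j₁,v⃗₁}` acts factorwise through the realised strip groups at ONE
collection `(i₁, v⃗₁)` over `2` (`ℓ⋆ ≥ 1`).
* §1 INPUT LEVEL at `p = 2`: **`lnνLp_hull_orbitH_lt_negLogThetaPerImageLoc_two_of_dyadicSqrtNegOne`** (`ln ν̄_{𝕃_2}(reading (P) over H_2) <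
  negLogThetaPerImageLoc I 2`) and **`lnνLp_hull_orbitH_indOneUnion_lt_negLogThetaLoc_two_of_dyadicSqrtNegOne`** (reading (U): `< negLogThetaLoc I 2`) — files 3/4 at
  `σ := I.σ`, `t := I.tΘ 2`, shell `mScale`.
* §2 GLOBAL: **`sum_lnνLp_hull_orbitH_lt_negLogThetaPerImageNonarch_of_dyadicSqrtNegOne`** and **`sum_lnνLp_hull_orbitH_indOneUnion_lt_negLogThetaNonarch_of_dyadicSqrtNegOne`**
  — the Θ-side over `H` is STRICTLY below `−|log(Θ)|^{(P),nonarch}` (resp. `−|log(Θ)|^{nonarch}`): the `2`-summand is strictly smaller (§1), every other summand is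
  `≤` (R31 §1); hence **`sum_lnνLp_hull_orbitH_ne_negLogThetaPerImageNonarch_of_dyadicSqrtNegOne`** — the GLOBAL IDENTITY of R32 §1 FAILS AS TYPED.
READING (numbers about OUR typed objects; neutral): R32 localised the global identity at the residual support primes `T(I) ∖ P ∋ 2` and left the `p = 2` summand
«NOT computed»; for inputs over a field `K ∋ √−1` all of whose section places over `2` have local degree `2` it is now COMPUTED AS TYPED: the `2`-summand identity
fails for every factorwise-strip `H` (files 3/4), so the global identity «Θ-side over H = Dupuy–Hilado's number» FAILS for every such input in BOTH readings,
independently of every bit, room inequality or Jannsen–Wingberg input at the odd primes; with R31 §4 (`cor312PerImageNonarchOf_of_negAbsLogQ_le_sum`) Cor. 3.12's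
nonarchimedean form over such an `H` is a STRICTLY tighter bound than Dupuy–Hilado's `Cor312PerImageNonarchOf I`.  HONEST SCOPE: OUR typings (THE equivariant
lift, THE logarithm, factorwise strips inside `indTwo` bounded by the trace ceiling; F-B28-1 untouched); nothing about non-factorwise or further indeterminacies
((Ind3), actions beyond `indTwo`); inputs with a dyadic section place of local degree `≠ 2` NOT treated; equal-AS-TYPED ≠ equal in print; calibrates
`stub_cor312PerImage` at the `p = 2` residual, discharges nothing; nothing here asserts that abc is proved or refuted; no side taken on [IUTchIII] Cor. 3.12 /
[IUTchIV] Thm. 1.10, on (U) vs (P), or on any author. [claim: Mochizuki2012, status: disputed]; [cite: Mochizuki2012, IUTchI Def. 3.1 (a)(e) pp. 61–62;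
IUTchIII Thm. 3.11 (i) p. 154; Cor. 3.12 pp. 173–174, proof Steps (x)/(xi) pp. 181–183; IUTchIV Thm. 1.10 Step (vi) p. 29, Prop. 1.4 (iii) p. 13];
[cite: DupuyHilado2025, §1 (1.1), Def. 3.6.3, §3.9, §4.9, §4.11, §4.12]; [cite: NeukirchANT1999, Ch. II Prop. (5.7), (6.8)]. typed ≠ proved; located ≠ adjudicated.
-/

set_option autoImplicit false

noncomputable section

open Metric Set Function Module
open scoped Pointwise TensorProduct

namespace Literature.IUT.LogVolume.ThetaVolumeInput

open Summit.ABC.IUTFork.Thm311.Real Literature.NumberTheory.NumberFields Function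
open Literature.NumberTheory.GaloisRepresentations Literature.NumberTheory.GaloisRepresentations.Ultrametric
open Literature.AnabelianGeometry.AbsoluteAnabelian Literature.IUT.HodgeArakelov
open Literature.IUT.HodgeArakelov.AbsTopMonoids NumberField IsDedekindDomain

variable {F₀ : Type} [Field F₀] [NumberField F₀] {K : Type} [Field K] [NumberField K] [Algebra F₀ K]
variable (I : ThetaVolumeInput F₀ K)

/-! ## §1 Input level at `p = 2`: both readings over a factorwise-strip `H` are STRICTLY below the Dupuy–Hilado `2`-summands -/

/-- **INPUT LEVEL, reading (P), `p = 2`: `ln ν̄_{𝕃_2}(reading (P) over H) < negLogThetaPerImageLoc I 2` (UNCONDITIONAL, no room condition)** — file 3's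
`localFields_lnνLp_hull_orbitH_lt_negLogThetaPerImageAt_of_dyadicSqrtNegOne` at `σ := I.σ`, `t := I.tΘ 2`, shell `mScale`; `K ∋ s`, `s² = −1`, every place of the
section over `2` of local degree `2`, `H ≤ indTwo` acting factorwise through the realised strip groups at one collection `(i₁, v⃗₁)`.
[claim: Mochizuki2012, status: disputed] [cite: Mochizuki2012, IUTchIII Thm. 3.11 (i) p. 154; Cor. 3.12 proof Step (x) p. 181]
[cite: DupuyHilado2025, Def. 3.6.3, §3.9, §4.9, §4.12] [cite: NeukirchANT1999, Ch. II Prop. (5.7), (6.8)] -/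
theorem lnνLp_hull_orbitH_lt_negLogThetaPerImageLoc_two_of_dyadicSqrtNegOne {s : K} (hs : s ^ 2 = -1)
    (hd : ∀ w : placesOver F₀ 2, localDeg K (I.σ.lift w.1) = 2)
    (H : (j : ℕ) → (e : Fin (j + 1) → placesOver F₀ 2) →
      Subgroup (PacketAlgebra 2 (fun b => (I.σ.localFields 2).k (e b)) ≃ₗ[ℚ_[2]]
        PacketAlgebra 2 (fun b => (I.σ.localFields 2).k (e b))))
    (hH : ∀ j e, H j e ≤ indTwo 2 (fun b => (I.σ.localFields 2).k (e b)))
    (i₁ : Fin I.lstar) (e₁ : Fin ((i₁ : ℕ) + 1 + 1) → placesOver F₀ 2)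
    (hHfac : ∀ γ ∈ H ((i₁ : ℕ) + 1) e₁, ∃ δ : Π b, AddAut ((I.σ.lift (e₁ b).1).adicCompletion K),
      (∀ b, δ b ∈ AddSubgroup.closure (G := AddAut ((I.σ.lift (e₁ b).1).adicCompletion K))
        (ind1StripOf (I.σ.lift (e₁ b).1) (galoisLog (I.σ.lift (e₁ b).1)))) ∧
      ∀ z : Π b, (I.σ.localFields 2).k (e₁ b),
        (γ : PacketAlgebra 2 (fun b => (I.σ.localFields 2).k (e₁ b)) ≃ₗ[ℚ_[2]]
            PacketAlgebra 2 (fun b => (I.σ.localFields 2).k (e₁ b))) (PiTensorProduct.tprod ℚ_[2] z) =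
          PiTensorProduct.tprod ℚ_[2] (fun b => RescaledCompletion.of K 2 (I.σ.lift (e₁ b).1) (I.σ.natCast_mem_lift (e₁ b))
            (δ b ((RescaledCompletion.of K 2 (I.σ.lift (e₁ b).1) (I.σ.natCast_mem_lift (e₁ b))).symm (z b))))) :
    (I.packetAt 2 Nat.prime_two).lnνLp I.lstar (fun j e =>
        packetHull 2 (fun b => (I.σ.localFields 2).k (e b))
          (⋃ g : H j e, (g : PacketAlgebra 2 (fun b => (I.σ.localFields 2).k (e b)) ≃ₗ[ℚ_[2]]
              PacketAlgebra 2 (fun b => (I.σ.localFields 2).k (e b))) ''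
            (I.packetAt 2 Nat.prime_two).pilotRegion (I.tΘ 2 Nat.prime_two) j e)) <
      I.negLogThetaPerImageLoc 2 := by
  rw [negLogThetaPerImageLoc_of_prime I Nat.prime_two]
  exact localFields_lnνLp_hull_orbitH_lt_negLogThetaPerImageAt_of_dyadicSqrtNegOne I.σ (mScale 2 (I.σ.localFields 2))
    (mScale_ne_zero 2 (I.σ.localFields 2)) (mScale_perm 2 (I.σ.localFields 2)) hs hd (I.tΘ 2 Nat.prime_two) H hH i₁ e₁ hHfac

/-- **INPUT LEVEL, reading (U), `p = 2`: `ln ν̄_{𝕃_2}(reading (U) over H) < negLogThetaLoc I 2` (UNCONDITIONAL, no room condition)** — file 4's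
`localFields_lnνLp_hull_orbitH_indOneUnion_lt_negLogThetaAt_of_dyadicSqrtNegOne` at `σ := I.σ`, `t := I.tΘ 2`. [claim: Mochizuki2012, status: disputed]
[cite: Mochizuki2012, IUTchIII Thm. 3.11 (i) p. 154; Cor. 3.12 p. 174] [cite: DupuyHilado2025, Def. 3.6.3, §4.7, §4.11, §4.12] [cite: NeukirchANT1999, Ch. II
Prop. (5.7), (6.8)] -/
theorem lnνLp_hull_orbitH_indOneUnion_lt_negLogThetaLoc_two_of_dyadicSqrtNegOne {s : K} (hs : s ^ 2 = -1)
    (hd : ∀ w : placesOver F₀ 2, localDeg K (I.σ.lift w.1) = 2)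
    (H : (j : ℕ) → (e : Fin (j + 1) → placesOver F₀ 2) →
      Subgroup (PacketAlgebra 2 (fun b => (I.σ.localFields 2).k (e b)) ≃ₗ[ℚ_[2]]
        PacketAlgebra 2 (fun b => (I.σ.localFields 2).k (e b))))
    (hH : ∀ j e, H j e ≤ indTwo 2 (fun b => (I.σ.localFields 2).k (e b)))
    (i₁ : Fin I.lstar) (e₁ : Fin ((i₁ : ℕ) + 1 + 1) → placesOver F₀ 2)
    (hHfac : ∀ γ ∈ H ((i₁ : ℕ) + 1) e₁, ∃ δ : Π b, AddAut ((I.σ.lift (e₁ b).1).adicCompletion K),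
      (∀ b, δ b ∈ AddSubgroup.closure (G := AddAut ((I.σ.lift (e₁ b).1).adicCompletion K))
        (ind1StripOf (I.σ.lift (e₁ b).1) (galoisLog (I.σ.lift (e₁ b).1)))) ∧
      ∀ z : Π b, (I.σ.localFields 2).k (e₁ b),
        (γ : PacketAlgebra 2 (fun b => (I.σ.localFields 2).k (e₁ b)) ≃ₗ[ℚ_[2]]
            PacketAlgebra 2 (fun b => (I.σ.localFields 2).k (e₁ b))) (PiTensorProduct.tprod ℚ_[2] z) =
          PiTensorProduct.tprod ℚ_[2] (fun b => RescaledCompletion.of K 2 (I.σ.lift (e₁ b).1) (I.σ.natCast_mem_lift (e₁ b))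
            (δ b ((RescaledCompletion.of K 2 (I.σ.lift (e₁ b).1) (I.σ.natCast_mem_lift (e₁ b))).symm (z b))))) :
    (I.packetAt 2 Nat.prime_two).lnνLp I.lstar (fun j e =>
        packetHull 2 (fun b => (I.σ.localFields 2).k (e b))
          (⋃ g : H j e, (g : PacketAlgebra 2 (fun b => (I.σ.localFields 2).k (e b)) ≃ₗ[ℚ_[2]]
              PacketAlgebra 2 (fun b => (I.σ.localFields 2).k (e b))) ''
            ⋃ τ : Equiv.Perm (Fin (j + 1)), (I.packetAt 2 Nat.prime_two).perm τ e ''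
              (I.packetAt 2 Nat.prime_two).pilotRegion (I.tΘ 2 Nat.prime_two) j (e ∘ τ))) <
      I.negLogThetaLoc 2 := by
  rw [negLogThetaLoc_of_prime I Nat.prime_two]
  exact localFields_lnνLp_hull_orbitH_indOneUnion_lt_negLogThetaAt_of_dyadicSqrtNegOne I.σ (mScale 2 (I.σ.localFields 2))
    (mScale_ne_zero 2 (I.σ.localFields 2)) (mScale_perm 2 (I.σ.localFields 2)) hs hd (I.tΘ 2 Nat.prime_two) H hH i₁ e₁ hHfac

/-! ## §2 GLOBAL: the nonarchimedean Θ-side over `H` is STRICTLY below Dupuy–Hilado's number; the global identity FAILS AS TYPED -/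

/-- **GLOBAL STRICTNESS AT THE DYADIC RESIDUAL, reading (P) (UNCONDITIONAL).**  For a genuine Θ-volume input over a field `K ∋ s`, `s² = −1`, all of whose
section places over `2` have local degree `2`, and ANY prime-indexed family `H ≤ indTwo` whose member `H_{2,j₁,v⃗₁}` at ONE collection over `2` acts factorwise
through the realised strip groups: the nonarchimedean Θ-side over `H` is STRICTLY below `−|log(Θ)|^{(P),nonarch}` — the `2`-summand (`2 ∈ T(I)`,
`two_mem_supportPrimes`) is strictly smaller (§1), every other summand is `≤` (R31 §1).  No hypothesis at any odd prime.
[claim: Mochizuki2012, status: disputed] [cite: Mochizuki2012, IUTchIII Thm. 3.11 (i) p. 154; Cor. 3.12 pp. 173–174, proof Step (x) p. 181; IUTchIV Thm. 1.10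
Step (vi) p. 29] [cite: DupuyHilado2025, §1 (1.1), Def. 3.6.3, §3.9, §4.9, §4.12] -/
theorem sum_lnνLp_hull_orbitH_lt_negLogThetaPerImageNonarch_of_dyadicSqrtNegOne {s : K} (hs : s ^ 2 = -1)
    (hd : ∀ w : placesOver F₀ 2, localDeg K (I.σ.lift w.1) = 2)
    (H : ∀ (p : ℕ) (hp : p.Prime), haveI : Fact p.Prime := ⟨hp⟩
      (j : ℕ) → (e : Fin (j + 1) → placesOver F₀ p) →
        Subgroup (PacketAlgebra p (fun b => (I.σ.localFields p).k (e b)) ≃ₗ[ℚ_[p]]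
          PacketAlgebra p (fun b => (I.σ.localFields p).k (e b))))
    (hH : ∀ (p : ℕ) (hp : p.Prime), haveI : Fact p.Prime := ⟨hp⟩; ∀ j e, H p hp j e ≤ indTwo p (fun b => (I.σ.localFields p).k (e b)))
    (i₁ : Fin I.lstar) (e₁ : Fin ((i₁ : ℕ) + 1 + 1) → placesOver F₀ 2)
    (hHfac : ∀ γ ∈ H 2 Nat.prime_two ((i₁ : ℕ) + 1) e₁, ∃ δ : Π b, AddAut ((I.σ.lift (e₁ b).1).adicCompletion K),
      (∀ b, δ b ∈ AddSubgroup.closure (G := AddAut ((I.σ.lift (e₁ b).1).adicCompletion K))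
        (ind1StripOf (I.σ.lift (e₁ b).1) (galoisLog (I.σ.lift (e₁ b).1)))) ∧
      ∀ z : Π b, (I.σ.localFields 2).k (e₁ b),
        (γ : PacketAlgebra 2 (fun b => (I.σ.localFields 2).k (e₁ b)) ≃ₗ[ℚ_[2]]
            PacketAlgebra 2 (fun b => (I.σ.localFields 2).k (e₁ b))) (PiTensorProduct.tprod ℚ_[2] z) =
          PiTensorProduct.tprod ℚ_[2] (fun b => RescaledCompletion.of K 2 (I.σ.lift (e₁ b).1) (I.σ.natCast_mem_lift (e₁ b))
            (δ b ((RescaledCompletion.of K 2 (I.σ.lift (e₁ b).1) (I.σ.natCast_mem_lift (e₁ b))).symm (z b))))) :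
    (∑ p ∈ I.supportPrimes, if hp : p.Prime then
        (haveI : Fact p.Prime := ⟨hp⟩
        (I.packetAt p hp).lnνLp I.lstar (fun j e =>
          packetHull p (fun b => (I.σ.localFields p).k (e b))
            (⋃ g : H p hp j e, (g : PacketAlgebra p (fun b => (I.σ.localFields p).k (e b)) ≃ₗ[ℚ_[p]]
                PacketAlgebra p (fun b => (I.σ.localFields p).k (e b))) ''
              (I.packetAt p hp).pilotRegion (I.tΘ p hp) j e))) else 0) <
      I.negLogThetaPerImageNonarch := by
  unfold negLogThetaPerImageNonarch
  refine Finset.sum_lt_sum (fun p hpT => ?_) ⟨2, I.two_mem_supportPrimes, ?_⟩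
  · have hp : p.Prime := I.prime_of_mem_supportPrimes hpT
    rw [dif_pos hp]
    exact I.lnνLp_hull_orbitH_le_negLogThetaPerImageLoc hp (H p hp) (hH p hp)
  · rw [dif_pos Nat.prime_two]
    exact I.lnνLp_hull_orbitH_lt_negLogThetaPerImageLoc_two_of_dyadicSqrtNegOne hs hd (H 2 Nat.prime_two) (hH 2 Nat.prime_two) i₁ e₁ hHfac

/-- **THE GLOBAL IDENTITY OF R32 §1 FAILS AS TYPED** (same hypotheses): «Θ-side over `H` = `−|log(Θ)|^{(P),nonarch}`» is FALSE for every such input — by R32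
§1 (`sum_lnνLp_hull_orbitH_eq_negLogThetaPerImageNonarch_iff_forall_eq`) it would force the `2`-summand identity, which §1 refutes; equivalently the strict
inequality above. [claim: Mochizuki2012, status: disputed] [cite: Mochizuki2012, IUTchIII Cor. 3.12 pp. 173–174, proof Step (x) p. 181; IUTchIV Thm. 1.10
Step (vi) p. 29] [cite: DupuyHilado2025, §1 (1.1), Def. 3.6.3, §4.12] -/
theorem sum_lnνLp_hull_orbitH_ne_negLogThetaPerImageNonarch_of_dyadicSqrtNegOne {s : K} (hs : s ^ 2 = -1)
    (hd : ∀ w : placesOver F₀ 2, localDeg K (I.σ.lift w.1) = 2)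
    (H : ∀ (p : ℕ) (hp : p.Prime), haveI : Fact p.Prime := ⟨hp⟩
      (j : ℕ) → (e : Fin (j + 1) → placesOver F₀ p) →
        Subgroup (PacketAlgebra p (fun b => (I.σ.localFields p).k (e b)) ≃ₗ[ℚ_[p]]
          PacketAlgebra p (fun b => (I.σ.localFields p).k (e b))))
    (hH : ∀ (p : ℕ) (hp : p.Prime), haveI : Fact p.Prime := ⟨hp⟩; ∀ j e, H p hp j e ≤ indTwo p (fun b => (I.σ.localFields p).k (e b)))
    (i₁ : Fin I.lstar) (e₁ : Fin ((i₁ : ℕ) + 1 + 1) → placesOver F₀ 2)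
    (hHfac : ∀ γ ∈ H 2 Nat.prime_two ((i₁ : ℕ) + 1) e₁, ∃ δ : Π b, AddAut ((I.σ.lift (e₁ b).1).adicCompletion K),
      (∀ b, δ b ∈ AddSubgroup.closure (G := AddAut ((I.σ.lift (e₁ b).1).adicCompletion K))
        (ind1StripOf (I.σ.lift (e₁ b).1) (galoisLog (I.σ.lift (e₁ b).1)))) ∧
      ∀ z : Π b, (I.σ.localFields 2).k (e₁ b),
        (γ : PacketAlgebra 2 (fun b => (I.σ.localFields 2).k (e₁ b)) ≃ₗ[ℚ_[2]]
            PacketAlgebra 2 (fun b => (I.σ.localFields 2).k (e₁ b))) (PiTensorProduct.tprod ℚ_[2] z) =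
          PiTensorProduct.tprod ℚ_[2] (fun b => RescaledCompletion.of K 2 (I.σ.lift (e₁ b).1) (I.σ.natCast_mem_lift (e₁ b))
            (δ b ((RescaledCompletion.of K 2 (I.σ.lift (e₁ b).1) (I.σ.natCast_mem_lift (e₁ b))).symm (z b))))) :
    (∑ p ∈ I.supportPrimes, if hp : p.Prime then
        (haveI : Fact p.Prime := ⟨hp⟩
        (I.packetAt p hp).lnνLp I.lstar (fun j e =>
          packetHull p (fun b => (I.σ.localFields p).k (e b))
            (⋃ g : H p hp j e, (g : PacketAlgebra p (fun b => (I.σ.localFields p).k (e b)) ≃ₗ[ℚ_[p]]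
                PacketAlgebra p (fun b => (I.σ.localFields p).k (e b))) ''
              (I.packetAt p hp).pilotRegion (I.tΘ p hp) j e))) else 0) ≠
      I.negLogThetaPerImageNonarch :=
  (I.sum_lnνLp_hull_orbitH_lt_negLogThetaPerImageNonarch_of_dyadicSqrtNegOne hs hd H hH i₁ e₁ hHfac).ne

/-- **GLOBAL STRICTNESS AT THE DYADIC RESIDUAL, reading (U) (the cell's reading of record; UNCONDITIONAL).**  Same hypotheses: the nonarchimedean Θ-side over `H`
in reading (U) is STRICTLY below `−|log(Θ)|^{nonarch}` (§1 at `2`, R31 §1 elsewhere), hence never equal to it. [claim: Mochizuki2012, status: disputed]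
[cite: Mochizuki2012, IUTchIII Thm. 3.11 (i) p. 154; Cor. 3.12 p. 174] [cite: DupuyHilado2025, §1 (1.1), Def. 3.6.3, §4.11, §4.12] -/
theorem sum_lnνLp_hull_orbitH_indOneUnion_lt_negLogThetaNonarch_of_dyadicSqrtNegOne {s : K} (hs : s ^ 2 = -1)
    (hd : ∀ w : placesOver F₀ 2, localDeg K (I.σ.lift w.1) = 2)
    (H : ∀ (p : ℕ) (hp : p.Prime), haveI : Fact p.Prime := ⟨hp⟩
      (j : ℕ) → (e : Fin (j + 1) → placesOver F₀ p) →
        Subgroup (PacketAlgebra p (fun b => (I.σ.localFields p).k (e b)) ≃ₗ[ℚ_[p]]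
          PacketAlgebra p (fun b => (I.σ.localFields p).k (e b))))
    (hH : ∀ (p : ℕ) (hp : p.Prime), haveI : Fact p.Prime := ⟨hp⟩; ∀ j e, H p hp j e ≤ indTwo p (fun b => (I.σ.localFields p).k (e b)))
    (i₁ : Fin I.lstar) (e₁ : Fin ((i₁ : ℕ) + 1 + 1) → placesOver F₀ 2)
    (hHfac : ∀ γ ∈ H 2 Nat.prime_two ((i₁ : ℕ) + 1) e₁, ∃ δ : Π b, AddAut ((I.σ.lift (e₁ b).1).adicCompletion K),
      (∀ b, δ b ∈ AddSubgroup.closure (G := AddAut ((I.σ.lift (e₁ b).1).adicCompletion K))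
        (ind1StripOf (I.σ.lift (e₁ b).1) (galoisLog (I.σ.lift (e₁ b).1)))) ∧
      ∀ z : Π b, (I.σ.localFields 2).k (e₁ b),
        (γ : PacketAlgebra 2 (fun b => (I.σ.localFields 2).k (e₁ b)) ≃ₗ[ℚ_[2]]
            PacketAlgebra 2 (fun b => (I.σ.localFields 2).k (e₁ b))) (PiTensorProduct.tprod ℚ_[2] z) =
          PiTensorProduct.tprod ℚ_[2] (fun b => RescaledCompletion.of K 2 (I.σ.lift (e₁ b).1) (I.σ.natCast_mem_lift (e₁ b))
            (δ b ((RescaledCompletion.of K 2 (I.σ.lift (e₁ b).1) (I.σ.natCast_mem_lift (e₁ b))).symm (z b))))) :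
    (∑ p ∈ I.supportPrimes, if hp : p.Prime then
        (haveI : Fact p.Prime := ⟨hp⟩
        (I.packetAt p hp).lnνLp I.lstar (fun j e =>
          packetHull p (fun b => (I.σ.localFields p).k (e b))
            (⋃ g : H p hp j e, (g : PacketAlgebra p (fun b => (I.σ.localFields p).k (e b)) ≃ₗ[ℚ_[p]]
                PacketAlgebra p (fun b => (I.σ.localFields p).k (e b))) ''
              ⋃ τ : Equiv.Perm (Fin (j + 1)), (I.packetAt p hp).perm τ e '' (I.packetAt p hp).pilotRegion (I.tΘ p hp) j (e ∘ τ)))) else 0) <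
      I.negLogThetaNonarch := by
  unfold negLogThetaNonarch
  refine Finset.sum_lt_sum (fun p hpT => ?_) ⟨2, I.two_mem_supportPrimes, ?_⟩
  · have hp : p.Prime := I.prime_of_mem_supportPrimes hpT
    rw [dif_pos hp]
    exact I.lnνLp_hull_orbitH_indOneUnion_le_negLogThetaLoc hp (H p hp) (hH p hp)
  · rw [dif_pos Nat.prime_two]
    exact I.lnνLp_hull_orbitH_indOneUnion_lt_negLogThetaLoc_two_of_dyadicSqrtNegOne hs hd (H 2 Nat.prime_two) (hH 2 Nat.prime_two) i₁ e₁ hHfac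

end Literature.IUT.LogVolume.ThetaVolumeInput

end
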